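import Summits.Ventures.LatticeQCDFlow.Scaling.TightSectorTwoStageStructure
import Summits.Ventures.LatticeQCDFlow.Scaling.TwoStageSuperSolution
import Summits.Ventures.LatticeQCDFlow.Scaling.TightSectorKLogKLaw
import Summits.Ventures.LatticeQCDFlow.Scaling.DominatedStarRegimeFreeTimeAverages

/-!
HONEST FRAMING: exact (Metropolis-corrected) sampling algorithms for lattice gauge theory; figures
of merit are autocorrelation/cost numbers at stated couplings and volumes; no continuum-physics
claim.

# TightSectorRefreshKLogK — THE REFRESH BUDGET'S `log K` WITH THE MAP QUALITY: THE MAP-ASSISTED HUB HAS THE TWO-STAGE STRUCTURE (A PLANTED LABEL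
# REACHES THE HUB AT RATE `≤ t·ĉ·p'·q'/m` PER LABELLED REPLICA, DIES THERE AT RATE `≤ (1−t)w_0`, AND IS PUSHED BACK INTO AN UNLABELLED REPLICA AT RATE
# `≥ (t·c·p/(m·p'))·(K − V)`), SO `t_mix(ε) ≥ (c·p·K/(2ĉ·(1−t)w_0·p'²·q'))·log(((K+2)/4)(1−ε−μ_0(A)−Kθ))` WHENEVER `2(1−t)w_0 ≤ t·c·K·p/(m·p')` —
# FOR EVERY HOT SAMPLER (lean-2 GEN-29, ours)

Venture-side (OURS).  Cell `lqcd-flow` (pub-lqcd), unit `pub-lqcd-lean-2-g29`, 2026-08-28.  Chapter O, file 14: `Scaling/TwoStageCountFloor` (O11) and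
`Scaling/TwoStageSuperSolution` (O12) applied to the chapter-M/N scheme through the structure of `Scaling/TightSectorTwoStageStructure` (O13), with `V(x) = #{k : x_{k+1} ∈ A}` (O7) and the hub bit `b(x) = [x_0 ∈ A]`.
The structure: every transition keeps the census `[x_0 ∈ A] + V(x)` (swaps, chapter K) or moves one coordinate without crossing `A` at a cold level
(sector-idle kernels), so from an unlabelled hub `V` drops only by sending the label to the hub, and from a labelled hub `V` never drops; the death
mass is the hot update's (`≤ (1−t)w_0`, ANY hot kernel); the push-back mass is at least `(t/m)·(p/p')` per entry at an unlabelled replica (one-sided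
domination `p` bounds `μ_0(φ_r⁻¹x_l)/μ_l(x_l) ≥ p` at the light content, pointwise tightness bounds `μ_l(φ_r x_0)/μ_0(x_0) ≥ 1/p'` at the label), and
every unlabelled replica carries `≥ c` entries.  With O7's drop rate `α = t·ĉ·p'·q'/m` and O12's `λ = 2hα/β`, `β = t·c·K·p/(m·p')`.

## What is proved

* `twoStage_badMass_le` — `π̃{hub labelled or some replica labelled} ≤ μ_0(A) + Kθ`.
* **`tightSector_mixingTime_ge_refreshKLogK`** — planted start (every cold replica in `A`, hub not), `2(1−t)w_0 ≤ t·c·K·p/(m·p')`,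
  `ε + μ_0(A) + Kθ < 1`, the chain `ε`-close at some time: **`t_mix(ε) ≥ (c·p·K/(2·ĉ·(1−t)w_0·p'²·q'))·log(((K+2)/4)·(1−ε−μ_0(A)−Kθ))`**;
  **`dominatedStar_mixingTime_ge_refreshKLogK`** — the closeness discharged for exact hot redraws;
  **`boolWitness_mixingTime_ge_refreshKLogK`** — on the two-point witness: **`t_mix(ε) ≥ (c·K/(2(1−t)w_0·ĉ·p))·log(((K+2)/4)(1−ε−pθ−Kθ))`** once
  `2(1−t)w_0 ≤ t·c·K/m`.

Reading (no numerics implied): with O8 (`(m/(t·ĉ·p'·q'))·log K`, the swap budget) the cold-start floor of the map-assisted hub carries the coupon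
collector's logarithm on BOTH budgets with the quality: the refresh floor exceeds the swap floor exactly when `t·c·K·p/(m·p') ≥ 2(1−t)w_0`, i.e.
when labels re-enter replicas faster than they die, which is the hypothesis here; on the two-point witness (`p' = p`, `q' ≤ 1`, `c = ĉ`, `m = cK`) the
floor reads `(K/(2(1−t)w_0·p))·log((K+2)(1−ε−pθ−Kθ)/4)` once `t ≥ 2(1−t)w_0` — against chapter N's refresh ceiling `7K/((1−t)w_0·p)` per relaxation.
OPEN-MATH items 7/8 are thereby closed on the floor side for both budgets, up to constants and the volume logarithm of the ceilings (item 1).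
NOT CLAIMED: anything measured.  Literature grade (cell rule): OWN RESULT; nothing cited as a fact; no new bib keys.
-/

noncomputable section

open Finset Function
open Literature.Probability.MarkovChains

namespace Summit.Ventures.LatticeQCDFlow.Scaling

variable {S : Type*} [Fintype S] [DecidableEq S] {K m : ℕ} {μ : Fin (K + 1) → S → ℝ} {M : Fin (K + 1) → S → S → ℝ}
  {w : Fin (K + 1) → ℝ} {t p : ℝ}

section Star
variable (κ : Fin m → Fin K) (φ : Fin m → Equiv.Perm S)

/-! ## §3 The refresh budget's `log K` with the quality -/

/-- `π̃{hub labelled or some replica labelled} ≤ μ_0(A) + Kθ` (every cold level gives `A` mass `≤ θ`). [ours] -/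
theorem twoStage_badMass_le (hμ : ∀ k x, 0 < μ k x) (hμ1 : ∀ k, ∑ u, μ k u = 1) {A : Finset S} {θ : ℝ}
    (hθ : ∀ k : Fin K, ∑ u ∈ A, μ k.succ u ≤ θ) :
    ∑ y ∈ univ.filter (fun y : Fin (K + 1) → S =>
        ¬((univ.filter (fun k : Fin K => y k.succ ∈ A)).card = 0 ∧ decide (y 0 ∈ A) = false)), tensorFun μ y
      ≤ (∑ u ∈ A, μ 0 u) + K * θ := by
  have hcold := coldLabel_mass_le (K := K) hμ hμ1 hθ
  have hhot : ∑ y ∈ univ.filter (fun y : Fin (K + 1) → S => y 0 ∈ A), tensorFun μ y = ∑ u ∈ A, μ 0 u := by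
    rw [Finset.sum_filter]
    have h := sum_tensorFun_mul_apply μ hμ1 0 (fun u => if u ∈ A then (1 : ℝ) else 0)
    simp_rw [mul_ite, mul_one, mul_zero] at h
    rw [h, ← Finset.sum_filter]
    congr 1; ext u; simp
  -- pointwise: the bad set is inside `{hub labelled} ∪ {V ≥ 1}`
  rw [Finset.sum_filter]
  have hpt : ∀ y : Fin (K + 1) → S,
      (if ¬((univ.filter (fun k : Fin K => y k.succ ∈ A)).card = 0 ∧ decide (y 0 ∈ A) = false) then tensorFun μ y else 0)
        ≤ (if y 0 ∈ A then tensorFun μ y else 0)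
          + (if 0 < (univ.filter (fun k : Fin K => y k.succ ∈ A)).card then tensorFun μ y else 0) := by
    intro y
    have hπ := (tensorFun_pos hμ y).le
    by_cases h0 : y 0 ∈ A
    · rw [if_pos h0]; split_ifs <;> linarith
    · rw [if_neg h0, zero_add]
      by_cases hV : (univ.filter (fun k : Fin K => y k.succ ∈ A)).card = 0
      · have : ((univ.filter (fun k : Fin K => y k.succ ∈ A)).card = 0 ∧ decide (y 0 ∈ A) = false) := ⟨hV, by simpa using h0⟩
        rw [if_neg (not_not.mpr this)]
        split_ifs <;> linarith
      · rw [if_pos (Nat.pos_of_ne_zero hV)]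
        split_ifs <;> linarith
  refine (sum_le_sum fun y _ => hpt y).trans ?_
  rw [sum_add_distrib, ← Finset.sum_filter, ← Finset.sum_filter, hhot]
  linarith

/-- **THE REFRESH BUDGET'S `log K` WITH THE QUALITY:** the chapter-M/N scheme with ANY hot kernel, cold kernels `μ_k`-stationary... (row-stochastic,
sector-idle), `0 < t < 1`, `w ≥ 0`, `Σw = 1`, `w_0 > 0`, one-sided domination `p > 0`, multiplicities in `[c, ĉ]` (`c ≥ 1`), `A`-preserving maps,
pointwise tightness `p'` on `A` and light-side ratio `q'`, every cold level giving `A` mass `≤ θ`; the regime `2(1−t)w_0 ≤ t·c·K·p/(m·p')` (labels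
re-enter replicas at least twice as fast as they die); planted start (every cold replica in `A`, the hub not); `ε + μ_0(A) + Kθ < 1`; the chain
`ε`-close to `π̃` at some time: **`t_mix(ε) ≥ (c·K·p/(2(1−t)w_0·ĉ·p'²·q'))·log(((K+2)/4)·(1−ε−(μ_0(A)+Kθ)))`**. [ours] -/
theorem tightSector_mixingTime_ge_refreshKLogK (hK : 1 ≤ K) (hm : 1 ≤ m) (hμ : ∀ k x, 0 < μ k x) (hμ1 : ∀ k, ∑ u, μ k u = 1)
    (hM : ∀ k, IsRowStochastic (M k)) (hw0 : ∀ k, 0 ≤ w k) (hw1 : ∑ k, w k = 1) (hw00 : 0 < w 0) (ht0 : 0 < t) (ht1 : t < 1)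
    (hp0 : 0 < p) (hdom : ∀ r u, p * μ (κ r).succ (φ r u) ≤ μ 0 u)
    {c : ℕ} (hc1 : 1 ≤ c) (hc : ∀ k : Fin K, c ≤ (univ.filter (fun r : Fin m => κ r = k)).card)
    {cmax : ℕ} (hcmax : ∀ k : Fin K, (univ.filter (fun r : Fin m => κ r = k)).card ≤ cmax)
    {A : Finset S} (hφA : ∀ r u, φ r u ∈ A ↔ u ∈ A) {p' q' : ℝ} (hp' : 0 < p') (hq' : 0 < q')
    (htight : ∀ r, ∀ z ∈ A, μ 0 ((φ r).symm z) ≤ p' * μ (κ r).succ z)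
    (hlight : ∀ r, ∀ u ∉ A, μ (κ r).succ (φ r u) ≤ q' * μ 0 u)
    (hidle : ∀ k : Fin (K + 1), k ≠ 0 → w k * edgeMeasure (μ k) (M k) A Aᶜ = 0)
    {θ : ℝ} (hθ : ∀ k : Fin K, ∑ u ∈ A, μ k.succ u ≤ θ)
    (hregime : 2 * ((1 - t) * w 0) ≤ t * c * K * p / (m * p'))
    (x : Fin (K + 1) → S) (hx : ∀ k : Fin K, x k.succ ∈ A) (hx0 : x 0 ∉ A)
    {ε : ℝ} (hε : ε + ((∑ u ∈ A, μ 0 u) + K * θ) < 1)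
    (hmix : ∃ n, worstTvDist (fun a b : Fin (K + 1) → S =>
          t * ptGraphSwap μ (fun r : Fin m => (((0 : Fin (K + 1)), (κ r).succ) : Fin (K + 1) × Fin (K + 1))) φ a b
            + (1 - t) * prodKernel w M a b) (tensorFun μ) n ≤ ε) :
    c * K * p / (2 * ((1 - t) * w 0) * cmax * p' ^ 2 * q') * Real.log (((K : ℝ) + 2) / 4 * (1 - ε - ((∑ u ∈ A, μ 0 u) + K * θ)))
      ≤ (mixingTime (fun a b : Fin (K + 1) → S =>
          t * ptGraphSwap μ (fun r : Fin m => (((0 : Fin (K + 1)), (κ r).succ) : Fin (K + 1) × Fin (K + 1))) φ a b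
            + (1 - t) * prodKernel w M a b) (tensorFun μ) ε : ℝ) := by
  have hmpos : (0 : ℝ) < m := Nat.cast_pos.mpr (by omega)
  have hKpos : (0 : ℝ) < K := Nat.cast_pos.mpr (by omega)
  have hcpos : (0 : ℝ) < c := Nat.cast_pos.mpr (by omega)
  have hcm : (1 : ℝ) ≤ cmax := by exact_mod_cast hc1.trans ((hc ⟨0, by omega⟩).trans (hcmax ⟨0, by omega⟩))
  have h1t : 0 < 1 - t := by linarith
  have hP := weightedScheme_isRowStochastic (t := t) (w := w)
    (ptGraphSwap_isRowStochastic (e := fun r : Fin m => (((0 : Fin (K + 1)), (κ r).succ) : Fin (K + 1) × Fin (K + 1))) (φ := φ) hμ)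
    hM hw0 hw1 ht0.le ht1.le
  set α : ℝ := t * cmax * p' * q' / m with hαdef
  set hh : ℝ := (1 - t) * w 0 with hhdef
  set β0 : ℝ := t * c * K * p / (m * p') with hβ0def
  set β : ℕ → ℝ := fun v => t * c * p / (m * p') * ((K - v : ℕ) : ℝ) with hβdef
  have hαpos : 0 < α := by positivity
  have hhpos : 0 < hh := by positivity
  have hβnn : ∀ v, 0 ≤ β v := fun v => by positivity
  have hβlin : ∀ v : ℕ, v ≤ K → β0 / K * ((K : ℝ) - v) ≤ β v := by
    intro v hv
    rw [hβdef]; simp only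
    rw [Nat.cast_sub hv, hβ0def]
    apply le_of_eq; field_simp
  have hmain := twoStage_mixingTime_ge hP (fun y => (univ.filter (fun k : Fin K => y k.succ ∈ A)).card) (fun y => decide (y 0 ∈ A))
    (fun a b hba hab => tightSector_twoStage_S0 κ φ hμ hM hφA hidle a b hba hab)
    (fun a b hba hab => tightSector_twoStage_S1 κ φ hμ hM hφA hidle a b hba hab)
    hαpos hhpos hregime hβnn hK hβlin
    (fun a _ => tightSector_coldCount_drop_le κ φ hm hμ hM ht0.le hφA hp'.le hq'.le htight hlight hidle hcmax a)
    (fun a hba => tightSector_twoStage_R1 κ φ hμ hM hw0 hw1 ht1.le hφA a hba)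
    (fun a hba => tightSector_twoStage_R2 κ φ hm hμ hM hw0 ht0.le ht1.le hp0 hdom hc hφA hp' htight a hba)
    (sum_tensorFun_eq_one μ hμ1) (twoStage_badMass_le hμ hμ1 hθ) x
    (by rw [Finset.filter_true_of_mem (fun k _ => hx k), Finset.card_univ, Fintype.card_fin]) (by simpa using hx0) hε hmix
  -- the constant
  have hconst : β0 / (2 * hh * α) = c * K * p / (2 * ((1 - t) * w 0) * cmax * p' ^ 2 * q') := by
    rw [hβ0def, hhdef, hαdef]
    field_simp
  rw [← hconst]
  exact hmain

/-- **The same with the closeness discharged for exact hot redraws under one-sided domination** (`p ≤ 1`, reversible cold kernels, `ε > 0`). [ours] -/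
theorem dominatedStar_mixingTime_ge_refreshKLogK [Nontrivial S] (hK : 1 ≤ K) (hm : 1 ≤ m) (hμ : ∀ k x, 0 < μ k x)
    (hμ1 : ∀ k, ∑ u, μ k u = 1) (hM : ∀ k, IsRowStochastic (M k)) (hMrev : ∀ k, DetailedBalance (μ k) (M k))
    (hM0 : ∀ u v, M 0 u v = μ 0 v) (hw0 : ∀ k, 0 ≤ w k) (hw1 : ∑ k, w k = 1) (hw00 : 0 < w 0) (ht0 : 0 < t) (ht1 : t < 1)
    (hp0 : 0 < p) (hp1 : p ≤ 1) (hdom : ∀ r u, p * μ (κ r).succ (φ r u) ≤ μ 0 u)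
    {c : ℕ} (hc1 : 1 ≤ c) (hc : ∀ k : Fin K, c ≤ (univ.filter (fun r : Fin m => κ r = k)).card)
    {cmax : ℕ} (hcmax : ∀ k : Fin K, (univ.filter (fun r : Fin m => κ r = k)).card ≤ cmax)
    {A : Finset S} (hφA : ∀ r u, φ r u ∈ A ↔ u ∈ A) {p' q' : ℝ} (hp' : 0 < p') (hq' : 0 < q')
    (htight : ∀ r, ∀ z ∈ A, μ 0 ((φ r).symm z) ≤ p' * μ (κ r).succ z)
    (hlight : ∀ r, ∀ u ∉ A, μ (κ r).succ (φ r u) ≤ q' * μ 0 u)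
    (hidle : ∀ k : Fin (K + 1), k ≠ 0 → w k * edgeMeasure (μ k) (M k) A Aᶜ = 0)
    {θ : ℝ} (hθ : ∀ k : Fin K, ∑ u ∈ A, μ k.succ u ≤ θ)
    (hregime : 2 * ((1 - t) * w 0) ≤ t * c * K * p / (m * p'))
    (x : Fin (K + 1) → S) (hx : ∀ k : Fin K, x k.succ ∈ A) (hx0 : x 0 ∉ A)
    {ε : ℝ} (hε0 : 0 < ε) (hε : ε + ((∑ u ∈ A, μ 0 u) + K * θ) < 1) :
    c * K * p / (2 * ((1 - t) * w 0) * cmax * p' ^ 2 * q') * Real.log (((K : ℝ) + 2) / 4 * (1 - ε - ((∑ u ∈ A, μ 0 u) + K * θ)))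
      ≤ (mixingTime (fun a b : Fin (K + 1) → S =>
          t * ptGraphSwap μ (fun r : Fin m => (((0 : Fin (K + 1)), (κ r).succ) : Fin (K + 1) × Fin (K + 1))) φ a b
            + (1 - t) * prodKernel w M a b) (tensorFun μ) ε : ℝ) := by
  obtain ⟨x₀, -, hx₀⟩ := Finset.exists_min_image (univ : Finset (Fin (K + 1) → S)) (tensorFun μ) univ_nonempty
  have hmix : ∃ n : ℕ, worstTvDist (fun a b : Fin (K + 1) → S =>
      t * ptGraphSwap μ (fun r : Fin m => (((0 : Fin (K + 1)), (κ r).succ) : Fin (K + 1) × Fin (K + 1))) φ a b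
        + (1 - t) * prodKernel w M a b) (tensorFun μ) n ≤ ε :=
    ⟨_, dominatedStar_worstTvDist_le_regimeFree κ φ hK hm ht0 ht1 hw0 hw00 hw1 hμ hμ1 hM hMrev hM0 hp0 hp1 hdom hc1 hc
      (tensorFun_pos hμ x₀) (fun y => hx₀ y (mem_univ y)) hε0 (Nat.le_ceil _)⟩
  exact tightSector_mixingTime_ge_refreshKLogK κ φ hK hm hμ hμ1 hM hw0 hw1 hw00 ht0 ht1 hp0 hdom hc1 hc hcmax hφA hp' hq' htight hlight
    hidle hθ hregime x hx hx0 hε hmix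

/-- **ON THE TWO-POINT WITNESS: `t_mix(ε) ≥ (c·K/(2(1−t)w_0·ĉ·p))·log(((K+2)/4)(1−ε−(pθ+Kθ)))`** once `2(1−t)w_0 ≤ t·c·K/m` (cold laws `(θ,1−θ)`,
hot law `(pθ,1−pθ)`, identity maps, idle cold replicas, exact hot redraws; multiplicities in `[c, ĉ]`; planted start: every cold replica `⊤`, hub `⊥`;
`0 < ε`, `ε + pθ + Kθ < 1`). [ours] -/
theorem boolWitness_mixingTime_ge_refreshKLogK {θ : ℝ} (hK : 1 ≤ K) (hm : 1 ≤ m) (ht0 : 0 < t) (ht1 : t < 1) (hw0 : ∀ k, 0 ≤ w k)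
    (hw00 : 0 < w 0) (hw1 : ∑ k, w k = 1) (hp0 : 0 < p) (hp1 : p ≤ 1) (hθ0 : 0 < θ) (hθ1 : θ < 1)
    {c : ℕ} (hc1 : 1 ≤ c) (hc : ∀ p' : Fin K, c ≤ (univ.filter (fun r : Fin m => κ r = p')).card)
    {cmax : ℕ} (hcmax : ∀ k : Fin K, (univ.filter (fun r : Fin m => κ r = k)).card ≤ cmax)
    (hregime : 2 * ((1 - t) * w 0) ≤ t * c * K / m)
    (x : Fin (K + 1) → Bool) (hx : ∀ k : Fin K, x k.succ = true) (hx0 : x 0 = false)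
    {ε : ℝ} (hε0 : 0 < ε) (hε : ε + (p * θ + K * θ) < 1) :
    c * K / (2 * ((1 - t) * w 0) * cmax * p) * Real.log (((K : ℝ) + 2) / 4 * (1 - ε - (p * θ + K * θ)))
      ≤ (mixingTime (fun a b : Fin (K + 1) → Bool =>
              t * ptGraphSwap (fun (k : Fin (K + 1)) (b : Bool) =>
                    if k = 0 then (if b then p * θ else 1 - p * θ) else (if b then θ else 1 - θ))
                  (fun r : Fin m => (((0 : Fin (K + 1)), (κ r).succ) : Fin (K + 1) × Fin (K + 1)))
                  (fun _ : Fin m => Equiv.refl Bool) a b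
                + (1 - t) * prodKernel w (fun (k : Fin (K + 1)) (u v : Bool) =>
                    if k = 0 then (if v then p * θ else 1 - p * θ) else (if u = v then (1 : ℝ) else 0)) a b)
            (tensorFun (fun (k : Fin (K + 1)) (b : Bool) =>
              if k = 0 then (if b then p * θ else 1 - p * θ) else (if b then θ else 1 - θ))) ε : ℝ) := by
  have hpθ1 : p * θ < 1 := by nlinarith
  have hμ : ∀ (k : Fin (K + 1)) (b : Bool), 0 < (fun (k : Fin (K + 1)) (b : Bool) =>
      if k = 0 then (if b then p * θ else 1 - p * θ) else (if b then θ else 1 - θ)) k b := by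
    intro k b
    by_cases hk : k = 0
    · simp only [hk, if_true]; split_ifs; exacts [mul_pos hp0 hθ0, by linarith]
    · simp only [hk, if_false]; split_ifs; exacts [hθ0, by linarith]
  have hμ1 : ∀ k : Fin (K + 1), ∑ u, (fun (k : Fin (K + 1)) (b : Bool) =>
      if k = 0 then (if b then p * θ else 1 - p * θ) else (if b then θ else 1 - θ)) k u = 1 := by
    intro k
    by_cases hk : k = 0
    · simp only [hk, if_true]; exact sum_bool_law _
    · simp only [hk, if_false]; exact sum_bool_law _
  have hM := fun k : Fin (K + 1) => boolWitness_rowStochastic (K := K) hp0.le hp1 hθ0.le hθ1.le k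
  have hMrev := fun k : Fin (K + 1) => boolWitness_detailedBalance (K := K) (p := p) (θ := θ) k
  have hM0 : ∀ u v : Bool, (fun (k : Fin (K + 1)) (u v : Bool) =>
      if k = 0 then (if v then p * θ else 1 - p * θ) else (if u = v then (1 : ℝ) else 0)) 0 u v
      = (fun (k : Fin (K + 1)) (b : Bool) => if k = 0 then (if b then p * θ else 1 - p * θ) else (if b then θ else 1 - θ)) 0 v := by
    intro u v; simp only [if_true]
  have hdom := boolWitness_oneSided κ (K := K) (θ := θ) hp1
  have hφA : ∀ (r : Fin m) (u : Bool), (fun _ : Fin m => Equiv.refl Bool) r u ∈ ({true} : Finset Bool) ↔ u ∈ ({true} : Finset Bool) :=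
    fun r u => Iff.rfl
  have hidle := fun (k : Fin (K + 1)) (hk : k ≠ 0) => boolWitness_idle (K := K) (w := w) (p := p) (θ := θ) k hk
  have htight : ∀ r : Fin m, ∀ z ∈ ({true} : Finset Bool),
      (fun (k : Fin (K + 1)) (b : Bool) => if k = 0 then (if b then p * θ else 1 - p * θ) else (if b then θ else 1 - θ)) 0
          (((fun _ : Fin m => Equiv.refl Bool) r).symm z)
        ≤ p * (fun (k : Fin (K + 1)) (b : Bool) => if k = 0 then (if b then p * θ else 1 - p * θ) else (if b then θ else 1 - θ))
          (κ r).succ z := by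
    intro r z hz
    rw [Finset.mem_singleton] at hz
    subst hz
    simp only [Equiv.refl_symm, Equiv.refl_apply, if_true, Fin.succ_ne_zero, if_false]
    exact le_rfl
  have hlight : ∀ r : Fin m, ∀ u ∉ ({true} : Finset Bool),
      (fun (k : Fin (K + 1)) (b : Bool) => if k = 0 then (if b then p * θ else 1 - p * θ) else (if b then θ else 1 - θ)) (κ r).succ
          ((fun _ : Fin m => Equiv.refl Bool) r u)
        ≤ 1 * (fun (k : Fin (K + 1)) (b : Bool) => if k = 0 then (if b then p * θ else 1 - p * θ) else (if b then θ else 1 - θ)) 0 u := by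
    intro r u hu
    rw [Finset.mem_singleton] at hu
    have hu' : u = false := by cases u; rfl; exact absurd rfl hu
    subst hu'
    simp only [Equiv.refl_apply, Fin.succ_ne_zero, if_false, if_true, Bool.false_eq_true, one_mul]
    nlinarith
  have hθle : ∀ k : Fin K, ∑ u ∈ ({true} : Finset Bool), (fun (k : Fin (K + 1)) (b : Bool) =>
      if k = 0 then (if b then p * θ else 1 - p * θ) else (if b then θ else 1 - θ)) k.succ u ≤ θ := by
    intro k; simp only [Fin.succ_ne_zero, if_false]; exact (sum_sector_law θ).le
  have hhot : ∑ u ∈ ({true} : Finset Bool), (fun (k : Fin (K + 1)) (b : Bool) =>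
      if k = 0 then (if b then p * θ else 1 - p * θ) else (if b then θ else 1 - θ)) 0 u = p * θ := by
    simp only [if_true]; exact sum_sector_law (p * θ)
  have hxA : ∀ k : Fin K, x k.succ ∈ ({true} : Finset Bool) := fun k => Finset.mem_singleton.mpr (hx k)
  have hx0A : x 0 ∉ ({true} : Finset Bool) := by rw [Finset.mem_singleton, hx0]; exact Bool.false_ne_true
  have hregime' : 2 * ((1 - t) * w 0) ≤ t * c * K * p / (m * p) := by
    rw [show t * c * K * p / (m * p) = t * c * K / m by field_simp]; exact hregime
  have hε' : ε + (∑ u ∈ ({true} : Finset Bool), (fun (k : Fin (K + 1)) (b : Bool) =>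
      if k = 0 then (if b then p * θ else 1 - p * θ) else (if b then θ else 1 - θ)) 0 u + K * θ) < 1 := by rw [hhot]; exact hε
  have h := dominatedStar_mixingTime_ge_refreshKLogK κ (fun _ : Fin m => Equiv.refl Bool) hK hm hμ hμ1 hM hMrev hM0 hw0 hw1 hw00 ht0 ht1
    hp0 hp1 hdom hc1 hc hcmax hφA hp0 one_pos htight hlight hidle hθle hregime' x hxA hx0A hε0 hε'
  rw [hhot] at h
  have e : c * K * p / (2 * ((1 - t) * w 0) * cmax * p ^ 2 * 1) = c * K / (2 * ((1 - t) * w 0) * cmax * p) := by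
    field_simp
  rw [e] at h
  exact h

end Star

end Summit.Ventures.LatticeQCDFlow.Scaling

end
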